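import Summits.QuantumFields.YangMills.Theorems.BalabanUVNodesN12TowerProxiesOfClass
import Summits.QuantumFields.YangMills.Theorems.BalabanUVNodesN12GaugeLetterLocNumerics
import Literature.MathematicalPhysics.QuantumFieldTheory.Balaban1983to89.Node00.TorusCoverLevels
import HarnessLib

/-!
# BalabanUVNodes ∕ N12 — lattice bookkeeping for the CANONICAL WINDOW of the `k`-uniform window gauge letter (§1 of `…N12WindowGaugeLetterUniformCanonical`,
# split off under the 400-line rule): block labels of cover points, representatives with prescribed label, drift along words, corner blocks, feeds, block unions

Cell `pub-ymgap` (HUMAN RULINGS D-0062 ∕ D-0149), WIDTH SEAT `pub-ymgap-dag-n12-w6` g23 (node N12 = [B15]; key K1⁹ `stmt-QuantumFields-27364`, `--kind proof --supports … --as helper`;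
count-neutral).  THEOREMS ONLY (0 `def`, 0 `instance`, 0 `sorry`).  Door (j5) «canonical window» of this seat's HANDOFF (§g7 ∕ §g22).

WHAT.  Bookkeeping on the cover `π : ℤᵈ → T_η` (r15 `B15Eq112TorusCover`, NODE 00 `TorusCoverLevels`) used by `…N12WindowGaugeLetterUniformCanonical.hσW_uniform_canonical_of_plaqSmall` to
DISCHARGE the six window rows `X D₀ hXΩ hBox hWX hfeedsX` of this seat's g7 socket `N12WindowGaugeLetterUniformSocket.hσW_uniform_of_plaqSmall` (p675589) at the canonical window
`X := {x | B^k(x) ∈ castSite '' [lo − 5, hi + 5]}`: ★ `blockIter_cover_eq_castSite` (`B^k(π y) = castSite ⌊y ∕ L^k⌋`, NODE 00's `iterBlockOf_cover` read for `blockIter`∕`castSite`), `blockMap_add_apply_mem`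
(floor-quotient drift), ★ `exists_cover_eq_blockMap_eq` (a representative with PRESCRIBED block label), ★★ `exists_blockIter_walkEnd` (`|w| ≤ A·L^k ⇒` the label of `B^k(walkEnd x w)` is within `A` of
that of `B^k(x)`), ★ `blockMap_add_mem_Icc_of_mem_fineBox` (the corner blocks of the window plaquettes land in `[lo − 2, hi + 2]`), ★★ `blockIter_feeds_mem` (the feeds of a `k`-bond at label `z`
read fine bonds whose end-point blocks have labels in `[z − 3, z + 3]` — from ρ5b `N12TowerProxiesOfClass.feeds_subset_boxBonds`), ★ `mem_maxDomT_of_blockIter_eq` (`Ω_k(Z)` is a block union,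
r11 `isBlockUnion_maxDomT`), `reach_le_mul_pow` (`ℓ_k + m′L^k + L^k ≤ (2d + m′ + 2)·L^k`, dag-n12-w3's `budget_le`).

HONEST FRAMING.  Lattice bookkeeping by name over landed kernel theorems; nothing of Bałaban's estimates asserted or refuted; count-neutral; N12 NOT discharged; K1⁹ NOT closed; counts
of record unmoved (typed 28∕28 · discharged 8∕27); one finite 𝕋⁴ programme at fixed `ε = L^{-K}` — R4 closes the conditional rung `BalabanLadder.UV` only; no summit statement is proved
here and NOT the Yang–Mills mass gap (Clay); nothing continuum ∕ ℝ⁴ ∕ OS.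

References: [Balaban1987RG1] CMP 109 (1987) 249–301, (0.1) p.251; [Balaban1988Convergent] CMP 119 (1988) 243–285, (2.11)–(2.13) pp.256–257; [Balaban1989LargeFieldII] CMP 122 (1989)
355–392, (1.8) p.358; [Balaban1985Averaging] CMP 98 (1985) 17–51, (5)–(9) pp.18–19; [Balaban1985Variational] CMP 102 (1985) 277–309, (16)–(18) p.280.
-/

noncomputable section

namespace Summit.QuantumFields.YangMills.BalabanUVNodes.N12WindowGaugeLetterUniformCanonicalPrelim

open Literature.MathematicalPhysics.QuantumFieldTheory.Balaban1983to89
open T4Continuum B15DeterminingSets BlockAveraging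
open T4AxialGaugeSmallField (castSite castSite_apply castSite_add_e)
open B16Eq18Proof (box mem_box)
open B14.Eq213MaximalDomains (side)
open B14.Eq213DetSet (maxDomT isBlockUnion_maxDomT)
open B14.Eq216Concrete (feeds)
open B14.Eq22Determines (blockIter blockIter_zero blockIter_succ)
open B14DomainGeom (Pt)
open B15Eq112TorusCover (cover lift cover_lift cover_apply cover_add_pmul cover_eq_cover_iff per per_apply)
open B15LatticeCubeTorus (pmul)
open B5Eq118OneStroke (iterBlockOf iterBlockOf_zero iterBlockOf_succ)
open B7Prop1Explicit (e e_apply)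
open Literature.MathematicalPhysics.QuantumLattice (blockMap)
open Literature.MathematicalPhysics.QuantumFieldTheory.Balaban1983to89.Node00 (coverAt iterBlockOf_cover embIter_coverAt coverAt_add_period)
open LatticeWordCountBox (walkEnd_castSite)
open Summit.QuantumFields.YangMills.BalabanUVNodes.N12WindowNearRegionGeometry (abs_netDisp_le_length)
open Summit.QuantumFields.YangMills.BalabanUVNodes.N12TowerProxiesOfClass (feeds_subset_boxBonds)
open Summit.QuantumFields.YangMills.BalabanUVNodes.N12GaugeLetterLocNumerics (budget_le)

variable {P : Params}

/-! ## §1 Lattice bookkeeping on the cover: block labels of cover points, representatives, drift along words, corner blocks, feeds, block unions -/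

/-- The two tree spellings of the `j`-fold block map agree: `B14.Eq22Determines.blockIter = B5Eq118OneStroke.iterBlockOf`. [cite: Balaban1987RG1, (0.1) p.251 (bookkeeping)] -/
private theorem blockIter_eq_iterBlockOf : ∀ (j : ℕ) (x : Site P 0), blockIter j x = iterBlockOf j x
  | 0, _ => rfl
  | j + 1, x => by rw [blockIter_succ, iterBlockOf_succ, blockIter_eq_iterBlockOf j x]

/-- `B^j(π y) = castSite ⌊y ∕ L^j⌋` (standing range `j ≤ m + K`): the block label of a cover point is the projection of the coordinatewise floor quotient (NODE 00's
`iterBlockOf_cover`, read for `blockIter` and `castSite`). [cite: Balaban1987RG1, (0.1) p.251 (bookkeeping)] -/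
theorem blockIter_cover_eq_castSite {j : ℕ} (hj : j ≤ P.m + P.K) (y : Pt P.d) :
    blockIter j (cover P y) = (castSite (blockMap (P.L ^ j) y) : Site P j) := by
  rw [blockIter_eq_iterBlockOf, iterBlockOf_cover hj]
  rfl

/-- Floor-quotient drift: adding a vector of sup-norm `≤ A·q` moves every coordinate of `⌊· ∕ q⌋` by at most `A`. [folklore] -/
theorem blockMap_add_apply_mem {q : ℕ} (hq : 0 < q) (y n : Pt P.d) {A : ℕ} (hn : ∀ i, |n i| ≤ (A : ℤ) * q) (i : Fin P.d) :
    blockMap q y i - A ≤ blockMap q (y + n) i ∧ blockMap q (y + n) i ≤ blockMap q y i + A := by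
  have hq' : (0 : ℤ) < q := by exact_mod_cast hq
  have h1 := (abs_le.1 (hn i)).1
  have h2 := (abs_le.1 (hn i)).2
  simp only [blockMap, Pi.add_apply]
  constructor
  · have h : (y i + -(A : ℤ) * q) / q ≤ (y i + n i) / q := Int.ediv_le_ediv hq' (by linarith)
    rw [Int.add_mul_ediv_right _ _ hq'.ne'] at h
    linarith
  · have h : (y i + n i) / q ≤ (y i + (A : ℤ) * q) / q := Int.ediv_le_ediv hq' (by linarith)
    rw [Int.add_mul_ediv_right _ _ hq'.ne'] at h
    linarith

/-- `N₀ = L^k · N_k`: the site counts of the tower (`sitesPerDir j = 2L^{m+K−j}`). [cite: Balaban1987RG1, (0.1) p.251 (bookkeeping)] -/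
private theorem sitesPerDir_zero_eq_pow_mul {k : ℕ} (hk : k ≤ P.m + P.K) : P.sitesPerDir 0 = P.L ^ k * P.sitesPerDir k := by
  unfold Params.sitesPerDir
  rw [Nat.sub_zero, mul_left_comm, ← pow_add, Nat.add_sub_cancel' hk]

/-- A fine site with PRESCRIBED block label has a cover representative with exactly that floor quotient: if `B^k(x) = castSite z` then `x = π y` with `⌊y ∕ L^k⌋ = z` (shift the standard lift by a
period multiple). [cite: Balaban1987RG1, (0.1) p.251 (bookkeeping)] -/
theorem exists_cover_eq_blockMap_eq {k : ℕ} (hk : k ≤ P.m + P.K) {x : Site P 0} {z : Pt P.d} (hx : blockIter k x = (castSite z : Site P k)) :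
    ∃ y : Pt P.d, cover P y = x ∧ blockMap (P.L ^ k) y = z := by
  have hB : (castSite (blockMap (P.L ^ k) (lift P x)) : Site P k) = castSite z := by
    rw [← blockIter_cover_eq_castSite hk, cover_lift, hx]
  have hdvd : ∀ i, ((P.sitesPerDir k : ℕ) : ℤ) ∣ z i - blockMap (P.L ^ k) (lift P x) i := fun i =>
    (ZMod.intCast_eq_intCast_iff_dvd_sub _ _ _).1 (congr_fun hB i)
  choose v hv using hdvd
  have hN := sitesPerDir_zero_eq_pow_mul (P := P) hk
  have hq : ((P.L ^ k : ℕ) : ℤ) ≠ 0 := by exact_mod_cast (pow_pos P.L_pos k).ne'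
  refine ⟨lift P x + pmul (per P) v, by rw [cover_add_pmul, cover_lift], ?_⟩
  funext i
  have hvi := hv i
  simp only [blockMap, Pi.add_apply] at hvi ⊢
  have hp : pmul (per P) v i = ((P.sitesPerDir k : ℕ) : ℤ) * v i * ((P.L ^ k : ℕ) : ℤ) := by
    show ((per P i : ℕ) : ℤ) * v i = _
    rw [per_apply, hN]
    push_cast
    ring
  rw [hp, Int.add_mul_ediv_right _ _ hq]
  linarith

/-- ★ **BLOCK-LABEL DRIFT ALONG A WORD**: if `B^k(x) = castSite z` and `|w| ≤ A·L^k`, then `B^k(walkEnd x w) = castSite z′` with `z − A ≤ z′ ≤ z + A` coordinatewise (a word moves each fine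
coordinate by at most its length; floor quotients move by at most `A`). [cite: Balaban1987RG1, (0.1) p.251 (bookkeeping); Balaban1985Averaging, (5)–(9) pp.18–19 (lattice words)] -/
theorem exists_blockIter_walkEnd {k : ℕ} (hk : k ≤ P.m + P.K) {x : Site P 0} {z : Pt P.d} (hx : blockIter k x = (castSite z : Site P k))
    (w : List (Letter P.d)) {A : ℕ} (hw : w.length ≤ A * P.L ^ k) :
    ∃ z' : Pt P.d, (∀ i, z i - A ≤ z' i ∧ z' i ≤ z i + A) ∧ blockIter k (walkEnd x w) = (castSite z' : Site P k) := by
  obtain ⟨y, hyx, hyz⟩ := exists_cover_eq_blockMap_eq hk hx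
  refine ⟨blockMap (P.L ^ k) (y + fun ν => netDisp w ν), fun i => ?_, ?_⟩
  · rw [← hyz]
    refine blockMap_add_apply_mem (pow_pos P.L_pos k) y _ (fun i => ?_) i
    calc |netDisp w i| ≤ (w.length : ℤ) := abs_netDisp_le_length w i
      _ ≤ (A : ℤ) * ((P.L ^ k : ℕ) : ℤ) := by exact_mod_cast hw
  · have hcov : cover P y = (castSite y : Site P 0) := rfl
    have hwalk : walkEnd (cover P y) w = cover P (y + fun ν => netDisp w ν) := by
      rw [hcov, walkEnd_castSite]
      rfl
    rw [← hyx, hwalk, blockIter_cover_eq_castSite hk]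

/-- `castSite` at level `j` is periodic under `N_j`-multiples (NODE 00 `coverAt_add_period`, read for `castSite`). [cite: Balaban1987RG1, (0.1) p.251 (bookkeeping)] -/
private theorem castSite_add_period (j : ℕ) (z v : Pt P.d) :
    (castSite (z + fun μ => ((P.sitesPerDir j : ℕ) : ℤ) * v μ) : Site P j) = castSite z :=
  coverAt_add_period (P := P) j z v

/-- The CORNER BLOCKS of the window plaquettes: a fine point of the `hWbox` box `[L^k(lo − 2), L^k(hi + 3) − 2]`, moved by a `{0,1}`-vector, has block label in `[lo − 2, hi + 2]`.
[cite: Balaban1989LargeFieldII, (1.8) p.358 (the parallelepiped; bookkeeping)] -/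
theorem blockMap_add_mem_Icc_of_mem_fineBox {k : ℕ} {lo hi : Fin P.d → ℤ} (hlohi : lo ≤ hi) {zf : Pt P.d}
    (hzf : zf ∈ box (fun κ => P.L ^ k * ((hi κ - lo κ + 1).toNat + 3 + 1) - 1) (fun κ => (P.L : ℤ) ^ k * (lo κ - 2)))
    (t : Pt P.d) (ht0 : ∀ i, 0 ≤ t i) (ht1 : ∀ i, t i ≤ 1) (i : Fin P.d) :
    lo i - 2 ≤ blockMap (P.L ^ k) (zf + t) i ∧ blockMap (P.L ^ k) (zf + t) i ≤ hi i + 2 := by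
  obtain ⟨hlo, hhi⟩ := (mem_box.1 hzf) i
  have hq : (0 : ℤ) < (P.L : ℤ) ^ k := by have := P.L_pos; positivity
  have h1 : 1 ≤ P.L ^ k * ((hi i - lo i + 1).toNat + 3 + 1) := le_trans (pow_pos P.L_pos k) (Nat.le_mul_of_pos_right _ (by omega))
  have hside : ((P.L ^ k * ((hi i - lo i + 1).toNat + 3 + 1) - 1 : ℕ) : ℤ) = (P.L : ℤ) ^ k * (hi i - lo i + 5) - 1 := by
    rw [Nat.cast_sub h1]
    push_cast
    rw [Int.toNat_of_nonneg (by linarith [hlohi i])]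
    ring
  have hlo' : (P.L : ℤ) ^ k * (lo i - 2) ≤ zf i := hlo
  have hhi' : zf i < (P.L : ℤ) ^ k * (lo i - 2) + ((P.L ^ k * ((hi i - lo i + 1).toNat + 3 + 1) - 1 : ℕ) : ℤ) := hhi
  rw [hside] at hhi'
  have ht0i := ht0 i
  have ht1i := ht1 i
  show lo i - 2 ≤ (zf i + t i) / ((P.L ^ k : ℕ) : ℤ) ∧ (zf i + t i) / ((P.L ^ k : ℕ) : ℤ) ≤ hi i + 2
  rw [Nat.cast_pow]
  constructor
  · rw [Int.le_ediv_iff_mul_le hq]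
    linarith
  · have hlt : (zf i + t i) / (P.L : ℤ) ^ k < hi i + 3 := by
      rw [Int.ediv_lt_iff_lt_mul hq]
      linarith
    linarith

/-- ★ **THE BLOCKS READ BY THE FEEDS OF A `k`-BOND**: if `c₋ = castSite z` (level `k`), every fine bond `b₀ ∈ feeds k c` ((2.11): the bonds the `k`-fold average at `c` may read) has BOTH end-points
in `k`-blocks with labels in `[z − 3, z + 3]` (ρ5b `feeds_subset_boxBonds`: `b₀` lies in the coordinate box of half-width `3L^k − 3` (+2) about the centre `ι_k c₋ = π(L^k z + (L^k−1)∕2)`).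
[cite: Balaban1988Convergent, (2.11) p.256; Balaban1987RG1, (0.1) p.251] -/
theorem blockIter_feeds_mem {k : ℕ} (hk : k ≤ P.m + P.K) {c : PBond P k} {z : Pt P.d} (hc : c.src = (castSite z : Site P k))
    {b₀ : PBond P 0} (hb₀ : b₀ ∈ feeds k c) :
    (∃ z' : Pt P.d, (∀ i, z i - 3 ≤ z' i ∧ z' i ≤ z i + 3) ∧ blockIter k b₀.src = (castSite z' : Site P k)) ∧
    (∃ z' : Pt P.d, (∀ i, z i - 3 ≤ z' i ∧ z' i ≤ z i + 3) ∧ blockIter k b₀.tgt = (castSite z' : Site P k)) := by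
  obtain ⟨x₀, hlo, hhi, hsrc⟩ := feeds_subset_boxBonds hk c hb₀
  -- the centre of `c₋` on the cover: `lift (ι_k c₋) = L^k z + h − N₀ v`
  have hctr : cover P (lift P (embIter k c.src)) = cover P (fun μ => (P.L : ℤ) ^ k * z μ + ((P.L ^ k - 1) / 2 : ℕ)) := by
    rw [cover_lift, hc]
    exact embIter_coverAt hk z
  obtain ⟨v, hv⟩ := (cover_eq_cover_iff _ _).1 hctr
  have hq : (0 : ℤ) < (P.L : ℤ) ^ k := by have := P.L_pos; positivity
  have hq1 : 1 ≤ P.L ^ k := pow_pos P.L_pos k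
  -- per coordinate: the lift of the centre
  have hcoord : ∀ μ, (((embIter k c.src) μ).val : ℤ) = (P.L : ℤ) ^ k * z μ + (((P.L ^ k - 1) / 2 : ℕ) : ℤ) - ((P.sitesPerDir 0 : ℕ) : ℤ) * v μ := by
    intro μ
    have h : (P.L : ℤ) ^ k * z μ + (((P.L ^ k - 1) / 2 : ℕ) : ℤ) = lift P (embIter k c.src) μ + pmul (per P) v μ := congr_fun hv μ
    have hp : pmul (per P) v μ = ((P.sitesPerDir 0 : ℕ) : ℤ) * v μ := by
      show ((per P μ : ℕ) : ℤ) * v μ = _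
      rw [per_apply]
    have hl : lift P (embIter k c.src) μ = (((embIter k c.src) μ).val : ℤ) := rfl
    rw [hp, hl] at h
    linarith
  -- the translated representative `x₁ := x₀ + N₀ v` of `b₀₋`
  obtain ⟨x₁, hx₁⟩ : ∃ x₁ : Pt P.d, x₁ = x₀ + fun μ => ((P.sitesPerDir 0 : ℕ) : ℤ) * v μ := ⟨_, rfl⟩
  have hsrc₁ : b₀.src = cover P x₁ := by
    rw [hsrc, hx₁]
    exact (castSite_add_period 0 x₀ v).symm
  have htgt₁ : b₀.tgt = cover P (x₁ + e b₀.dir) := by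
    show b₀.src.shift b₀.dir = _
    rw [hsrc₁]
    exact (castSite_add_e x₁ b₀.dir).symm
  have hr : ((3 * P.L ^ k - 3 : ℕ) : ℤ) = 3 * (P.L : ℤ) ^ k - 3 := by
    rw [Nat.cast_sub (by omega)]
    push_cast
    ring
  have hh2' : 2 * (((P.L ^ k - 1) / 2 : ℕ) : ℤ) ≤ ((P.L ^ k : ℕ) : ℤ) - 1 := by omega
  have hh2 : 2 * (((P.L ^ k - 1) / 2 : ℕ) : ℤ) ≤ (P.L : ℤ) ^ k - 1 := by
    rw [← Nat.cast_pow]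
    exact hh2'
  have hh0 : (0 : ℤ) ≤ (((P.L ^ k - 1) / 2 : ℕ) : ℤ) := Nat.cast_nonneg _
  -- coordinate bounds of `x₁` and `x₁ + e`
  have hbounds : ∀ μ, (P.L : ℤ) ^ k * (z μ - 3) ≤ x₁ μ ∧ x₁ μ + e b₀.dir μ < (P.L : ℤ) ^ k * (z μ + 4) := by
    intro μ
    have h1 : (((embIter k c.src) μ).val : ℤ) - ((3 * P.L ^ k - 3 : ℕ) : ℤ) ≤ x₀ μ := hlo μ
    have h2 : x₀ μ + e b₀.dir μ ≤ (((embIter k c.src) μ).val : ℤ) + ((3 * P.L ^ k - 3 : ℕ) : ℤ) + 2 := hhi μ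
    rw [hcoord μ, hr] at h1 h2
    have hx₁μ : x₁ μ = x₀ μ + ((P.sitesPerDir 0 : ℕ) : ℤ) * v μ := by rw [hx₁]; rfl
    rw [hx₁μ]
    constructor
    · linarith
    · linarith
  have he0 : ∀ μ, 0 ≤ e b₀.dir μ := fun μ => by rw [e_apply]; split_ifs <;> norm_num
  have hlab : ∀ (t : Pt P.d), (∀ μ, 0 ≤ t μ) → (∀ μ, t μ ≤ e b₀.dir μ) →
      ∀ i, z i - 3 ≤ blockMap (P.L ^ k) (x₁ + t) i ∧ blockMap (P.L ^ k) (x₁ + t) i ≤ z i + 3 := by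
    intro t ht0 ht1 i
    obtain ⟨hl, hu⟩ := hbounds i
    have ht0i := ht0 i
    have ht1i := ht1 i
    show z i - 3 ≤ (x₁ i + t i) / ((P.L ^ k : ℕ) : ℤ) ∧ (x₁ i + t i) / ((P.L ^ k : ℕ) : ℤ) ≤ z i + 3
    rw [Nat.cast_pow]
    constructor
    · rw [Int.le_ediv_iff_mul_le hq]
      linarith
    · have hlt : (x₁ i + t i) / (P.L : ℤ) ^ k < z i + 4 := by
        rw [Int.ediv_lt_iff_lt_mul hq]
        linarith
      linarith
  refine ⟨⟨blockMap (P.L ^ k) (x₁ + 0), hlab 0 (fun _ => le_rfl) he0, ?_⟩, ⟨blockMap (P.L ^ k) (x₁ + e b₀.dir), hlab _ he0 (fun _ => le_rfl), ?_⟩⟩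
  · rw [hsrc₁, add_zero, blockIter_cover_eq_castSite hk]
  · rw [htgt₁, blockIter_cover_eq_castSite hk]

/-- A fine site whose `k`-block label lies in `(Ω_k(Z))^{(k)}` lies in `Ω_k(Z)` — `Ω_k(Z)` is a union of `k`-blocks ([III] (2.13), r11 `isBlockUnion_maxDomT`; `1 ≤ k ≤ m + K`, `1 ≤ M₁`,
`L^kM₁ ∣ 2L^{m+K}`). [cite: Balaban1988Convergent, (2.13) pp.256–257] -/
theorem mem_maxDomT_of_blockIter_eq {k : ℕ} (hk1 : 1 ≤ k) (hk : k ≤ P.m + P.K) {M₁ : ℕ} (hM : 1 ≤ M₁) {Z : Set (Site P 0)}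
    (hdiv : side P.L M₁ k ∣ P.sitesPerDir 0) {x : Site P 0} {z : Pt P.d} (hx : blockIter k x = (castSite z : Site P k))
    (hz : (castSite z : Site P k) ∈ pts k (maxDomT M₁ Z k)) : x ∈ maxDomT M₁ Z k := by
  rw [isBlockUnion_maxDomT hM (Ω := Z) hdiv hk1 le_rfl hk x, hx]
  exact hz

/-- THE REACH NUMERIC: `ℓ_k + m′·L^k + L^k ≤ (2d + m′ + 2)·L^k` (`ℓ_k ≤ 2dL^k + k + 1` by `budget_le`, `k + 1 ≤ L^k`). [cite: Balaban1985Variational, (16)–(18) p.280 (bookkeeping)] -/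
theorem reach_le_mul_pow (k : ℕ) :
    (∑ i ∈ Finset.range (k + 1), (P.d * ((P.L ^ i - 1) / 2) + 1)) + (3 * (P.d * ((P.L - 1) / 2)) + 5) * P.L ^ k + P.L ^ k ≤
      (2 * P.d + (3 * (P.d * ((P.L - 1) / 2)) + 5) + 2) * P.L ^ k := by
  have h1 := budget_le (P := P) k
  have h2 : k + 1 ≤ P.L ^ k := Nat.lt_pow_self P.hL.2
  have h3 : (2 * P.d + (3 * (P.d * ((P.L - 1) / 2)) + 5) + 2) * P.L ^ k = 2 * P.d * P.L ^ k + (3 * (P.d * ((P.L - 1) / 2)) + 5) * P.L ^ k + 2 * P.L ^ k := by ring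
  rw [h3]
  omega

end Summit.QuantumFields.YangMills.BalabanUVNodes.N12WindowGaugeLetterUniformCanonicalPrelim

end
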